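import Summits.HodgeConjecture.CorCM.Census.DihedralSexticPairCurve
import Summits.HodgeConjecture.CorCM.DihedralSexticPairFrameTransfer
import Summits.HodgeConjecture.CorCM.CMWeightLinesDisjointUnion
import Summits.HodgeConjecture.CorCM.DihedralSexticPairWeights
import HarnessLib

/-!
# COR-CM — frame transfer for `E × B₀ × B₁` (`K = k·F₀` non-Galois sextic CM): Galois-balanced weights of the
# three-slot product are model-balanced, and model decompositions yield algebraic weight lines

Cell `pub-hodgecm2` (COR-CM), seat b30 gen 14 (2026-08-21); COUNT-NEUTRAL; no named fact, no `sorry` (two auxiliary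
definitions: the slot map and the model map).  Bridge between the finite model `Census/DihedralSexticPairCurve.lean`
(14 points, census `balanced'_decomp`) and the real carriers, consumed by `CorCM/DihedralSexticPairCurveHodgeOfMarkman.lean`
(the Hodge conjecture for `E × B₀ × B₁` modulo Markman).

SETTING.  A family of CM fields `Kf : I → Type` and two indices `i₀` (the quadratic field `k = Kf i₀`, `τ : k → ℂ`)
and `i₁` (the sextic field `K = Kf i₁`, `i : k → K`); the three slots carry the fields `curveSlots i₀ i₁ = (i₀, i₁, i₁)`
(`Fin.cons`, so that the sub-family of the last two slots is DEFINITIONALLY the constant family `K`); realisations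
`A₃ j ⊨ (Kf (curveSlots j); Φ₃ j)`, with `Φ₃ 0 = {τ}` (`hΨ`) and `Φ₃ (m+1)` read in a FRAME
`e : Hom(K, ℂ) ≃ ℤ/3 × Bool` of `K` over `(k, i, τ)` as in `CorCM/DihedralSexticPairFrameTransfer.lean` (`hΦ`, `he_conj`,
`he_sign`, `he_gal`).  The model map `toPt'` sends `(0, σ)` to `inl [σ = τ]` and `(m+1, s)` to `inr (m, e s)`.

* §1 `balanced'_image_of_isGaloisBalancedAlg` — an `Aut(ℂ)`-balanced weight of `⨁ A₃` (`IsGaloisBalancedAlg` for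
  `k × K × K`) maps to a balanced model weight (the twelve elements of `S₃ × C₂` are realised by automorphisms of `ℂ`,
  `DihedralSexticPair.exists_ringEquiv_realises`, fixing or conjugating `τ` by their sign) [cite: GaoUllmo2025, Thm 3.1];
* §2 `weightClassesAlg_le_algebraicClasses_of_decomp` — a greedy model decomposition (`decomp`) plus the algebraicity
  of the `weil4`/`pair6` lines (hypotheses) make the line of `S` algebraic (conjugate pairs:
  `PairWeights.weightClassesAlg_le_algebraicClasses_of_conj_smul_mem`; unions:
  `PairWeights.weightClassesAlg_union_le_algebraicClasses`) [cite: VoisinHodgeII2003, Prop. 9.20];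
* §3 `hodgeConjectureFor_biproduct_curveSlots_of_generators` — by `Pohlmann1968_thm1_cmAlgebra` and the census,
  `HodgeConjectureFor (⨁ A₃)` given the two generator hypotheses.

## References
* [GaoUllmo2025] Gao–Ullmo, J. Inst. Math. Jussieu 25 (2025), Thm 3.1; [Pohlmann1968] Ann. of Math. 88, Thm 1;
  [Gordon1999HodgeAVSurvey] §9.2; [Milne2020HodgeClassesAV] 1.2 (a); [VoisinHodgeII2003] Prop. 9.20.
-/

noncomputable section

open CategoryTheory CategoryTheory.Limits NumberField

namespace Summit.HodgeConjecture.CorCM.DihedralSexticPairCurve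

open Literature.AlgebraicGeometry Literature.AlgebraicGeometry.Motives Literature.AlgebraicGeometry.HodgeTheory
open Literature.AlgebraicGeometry.ComplexMultiplication (IsCMTypeRealisation)
open Literature.AlgebraicGeometry.Pohlmann1968
open Literature.AlgebraicTopology.SingularHomology
open Literature.NumberTheory.ComplexMultiplication
open Summit.HodgeConjecture.CorCM.CMWeights (conj_smul_sigma_eq smul_sigma_eq)
open Summit.HodgeConjecture.CorCM.Census.DihedralSexticPair (Pt act phi weilPlus weilMinus act_apply mem_phi_iff
  weil_structure)
open Summit.HodgeConjecture.CorCM.Census.DihedralSexticPairCurve (Pt' act' phi' balanced' conjPair weil4 pair6 gens decomp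
  act'_inl act'_inr mem_phi'_inl mem_phi'_inr mem_gens_iff mem_conjPair_iff mem_weil4_iff mem_pair6_iff decomp_zero
  decomp_succ balanced'_decomp gens_balanced)
open Summit.HodgeConjecture.CorCM.DihedralSexticPair (act_mk_apply exists_ringEquiv_realises)
open Summit.HodgeConjecture.CorCM.PairWeights

open scoped Classical Pointwise

/-! ## §0 The slot map and the model map -/

section Defs

variable {I : Type}

/-- The fields of the three slots of `E × B₀ × B₁`: `(i₀, i₁, i₁)` — `Fin.cons`, so that `curveSlots i₀ i₁ (m+1)` is
DEFINITIONALLY `i₁` for every `m : Fin 2`. [folklore] -/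
def curveSlots (i₀ i₁ : I) : Fin 3 → I := Fin.cons i₀ fun _ : Fin 2 => i₁

variable {Kf : I → Type} [∀ i, Field (Kf i)] {i₀ i₁ : I}

/-- **The model map** `Hom(k × K × K, ℂ) → Pt'`: `(0, σ) ↦ inl [σ = τ]`, `(m+1, s) ↦ inr (m, e s)`. [folklore] -/
def toPt' (e : (Kf i₁ →+* ℂ) ≃ ZMod 3 × Bool) (τ : Kf i₀ →+* ℂ) :
    ((j : Fin 3) × (Kf (curveSlots i₀ i₁ j) →+* ℂ)) → Pt' := fun x =>
  Fin.cases (motive := fun j => (Kf (curveSlots i₀ i₁ j) →+* ℂ) → Pt')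
    (fun σ => Sum.inl (decide (σ = τ))) (fun m s => Sum.inr (m, e s)) x.1 x.2

/-- `toPt'` on the curve slot. [folklore] -/
@[simp] theorem toPt'_zero (e : (Kf i₁ →+* ℂ) ≃ ZMod 3 × Bool) (τ : Kf i₀ →+* ℂ) (σ : Kf i₀ →+* ℂ) :
    toPt' e τ ⟨0, σ⟩ = Sum.inl (decide (σ = τ)) := rfl

/-- `toPt'` on the threefold slots. [folklore] -/
@[simp] theorem toPt'_succ (e : (Kf i₁ →+* ℂ) ≃ ZMod 3 × Bool) (τ : Kf i₀ →+* ℂ) (m : Fin 2) (s : Kf i₁ →+* ℂ) :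
    toPt' e τ ⟨m.succ, s⟩ = Sum.inr (m, e s) := rfl

end Defs

/-! ## §1 Frame transfer for the three slots -/

section Transfer

variable {I : Type} {Kf : I → Type} [∀ i, Field (Kf i)]
  {i₀ i₁ : I} {e : (Kf i₁ →+* ℂ) ≃ ZMod 3 × Bool} {τ : Kf i₀ →+* ℂ}
  (hττ : ComplexEmbedding.conjugate τ ≠ τ) (hk : ∀ σ : Kf i₀ →+* ℂ, σ = τ ∨ σ = ComplexEmbedding.conjugate τ)

/-- Every point of the index set is `(0, σ)` or `(m+1, s)`. [folklore] -/
theorem sigma_cases (x : (j : Fin 3) × (Kf (curveSlots i₀ i₁ j) →+* ℂ)) :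
    (∃ σ : Kf i₀ →+* ℂ, x = ⟨0, σ⟩) ∨ ∃ (m : Fin 2) (s : Kf i₁ →+* ℂ), x = ⟨m.succ, s⟩ := by
  obtain ⟨j, s⟩ := x
  refine Fin.cases ?_ (fun m => ?_) j s
  · exact fun σ => Or.inl ⟨σ, rfl⟩
  · exact fun s => Or.inr ⟨m, s, rfl⟩

include hττ hk in
/-- The model map is injective (`Hom(k, ℂ) = {τ, τ̄}`). [folklore] -/
theorem toPt'_injective : Function.Injective (toPt' (i₀ := i₀) (i₁ := i₁) e τ) := by
  intro x y hxy
  rcases sigma_cases x with ⟨σ, rfl⟩ | ⟨m, s, rfl⟩ <;> rcases sigma_cases y with ⟨σ', rfl⟩ | ⟨m', s', rfl⟩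
  · rw [toPt'_zero, toPt'_zero, Sum.inl.injEq] at hxy
    rcases hk σ with rfl | rfl <;> rcases hk σ' with rfl | rfl
    · rfl
    · simp only [decide_true] at hxy; exact absurd (of_decide_eq_true hxy.symm) hττ
    · simp only [decide_true] at hxy; exact absurd (of_decide_eq_true hxy) hττ
    · rfl
  · exact absurd hxy (by rw [toPt'_zero, toPt'_succ]; exact Sum.inl_ne_inr)
  · exact absurd hxy (by rw [toPt'_zero, toPt'_succ]; exact Sum.inr_ne_inl)
  · rw [toPt'_succ, toPt'_succ, Sum.inr.injEq, Prod.mk.injEq] at hxy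
    obtain ⟨rfl, h2⟩ := hxy
    rw [e.injective h2]

include hττ hk in
/-- Counting through the model map. [folklore] -/
theorem ncard_sep_eq_card_filter_image' (S : Finset ((j : Fin 3) × (Kf (curveSlots i₀ i₁ j) →+* ℂ)))
    (P : ((j : Fin 3) × (Kf (curveSlots i₀ i₁ j) →+* ℂ)) → Prop) (Q : Pt' → Prop) [DecidablePred Q]
    (hPQ : ∀ x, P x ↔ Q (toPt' e τ x)) :
    {x | x ∈ S ∧ P x}.ncard = ((S.image (toPt' e τ)).filter Q).card := by
  rw [show {x | x ∈ S ∧ P x} = ↑(S.filter P) by ext x; simp, Set.ncard_coe_finset, Finset.filter_image,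
    Finset.card_image_of_injective _ (toPt'_injective hττ hk)]
  exact congrArg Finset.card (Finset.filter_congr fun x _ => hPQ x)

variable {i : Kf i₀ →+* Kf i₁}
  (he_sign : ∀ s : Kf i₁ →+* ℂ, s.comp i = τ ↔ (e s).2 = true)
  (he_conj : ∀ s : Kf i₁ →+* ℂ, e (ComplexEmbedding.conjugate s) = ((e s).1, !(e s).2))
  (he_gal : ∀ (j : ZMod 3) (f : Bool), ∃ σ : ℂ ≃+* ℂ, ∀ s : Kf i₁ →+* ℂ,
    e ((σ : ℂ →+* ℂ).comp s) = ((if f then -(e s).1 else (e s).1) + j, (e s).2))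

include hττ hk he_sign in
/-- **How a realiser acts on the curve slot**: if `ρ ∈ Aut(ℂ)` realises the model element `(j, f, d)` on `Hom(K, ℂ)`,
then `[ρ ∘ σ = τ] = [σ = τ]` if `d`, and `= ¬[σ = τ]` otherwise (`ρ` fixes `τ` iff it preserves the signs).
[cite: Gordon1999HodgeAVSurvey, §9.2] -/
theorem comp_eq_iff_of_realises (ρ : ℂ ≃+* ℂ) {j : ZMod 3} {f d : Bool}
    (hρ : ∀ s : Kf i₁ →+* ℂ, e ((ρ : ℂ →+* ℂ).comp s) =
      ((if f then -(e s).1 else (e s).1) + j, if d then (e s).2 else !(e s).2))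
    (σ : Kf i₀ →+* ℂ) :
    (ρ : ℂ →+* ℂ).comp σ = τ ↔ (if d then decide (σ = τ) else !decide (σ = τ)) = true := by
  -- `ρ ∘ τ = τ ↔ d`: read on an embedding `s₀` of `K` extending `τ`
  obtain ⟨s₀, hs₀⟩ := e.surjective (0, true)
  have hs₀τ : s₀.comp i = τ := (he_sign s₀).2 (by rw [hs₀])
  have hρτ : (ρ : ℂ →+* ℂ).comp τ = τ ↔ d = true := by
    have h1 : ((ρ : ℂ →+* ℂ).comp s₀).comp i = τ ↔ (e ((ρ : ℂ →+* ℂ).comp s₀)).2 = true := he_sign _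
    rw [RingHom.comp_assoc, hs₀τ, hρ s₀, hs₀] at h1
    rw [h1]
    cases d <;> simp
  -- `ρ` permutes `{τ, τ̄}`: `ρ ∘ τ̄ = τ ↔ ρ ∘ τ ≠ τ`
  have hinjρ : ∀ σ₁ σ₂ : Kf i₀ →+* ℂ, (ρ : ℂ →+* ℂ).comp σ₁ = (ρ : ℂ →+* ℂ).comp σ₂ → σ₁ = σ₂ :=
    fun σ₁ σ₂ h => RingHom.ext fun z => ρ.injective (by
      have e1 := RingHom.congr_fun h z
      simp only [RingHom.coe_comp, RingHom.coe_coe, Function.comp_apply] at e1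
      exact e1)
  have hρ2 : (ρ : ℂ →+* ℂ).comp (ComplexEmbedding.conjugate τ) = τ ↔ ¬ (ρ : ℂ →+* ℂ).comp τ = τ := by
    constructor
    · intro h1 h2
      exact hττ (hinjρ _ _ (h1.trans h2.symm))
    · intro h1
      rcases hk ((ρ : ℂ →+* ℂ).comp (ComplexEmbedding.conjugate τ)) with h2 | h2
      · exact h2
      · exfalso
        rcases hk ((ρ : ℂ →+* ℂ).comp τ) with h3 | h3
        · exact h1 h3
        · exact hττ (hinjρ _ _ (h2.trans h3.symm))
  rcases hk σ with rfl | rfl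
  · rw [hρτ]
    cases d <;> simp
  · rw [hρ2, hρτ]
    have hne : decide (ComplexEmbedding.conjugate τ = τ) = false := decide_eq_false hττ
    rw [hne]
    cases d <;> simp

variable {Φ₃ : ∀ j : Fin 3, CMType (Kf (curveSlots i₀ i₁ j))}
  (hΨ : ∀ σ : Kf i₀ →+* ℂ, σ ∈ (Φ₃ 0).1 ↔ σ = τ)
  (hΦ : ∀ (m : Fin 2) (s : Kf i₁ →+* ℂ), s ∈ (Φ₃ m.succ).1 ↔ (e s).2 = decide ((e s).1.val = m.val))

include hττ hk he_sign hΨ hΦ in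
/-- **Membership read in the frame (three slots)**: for a realiser `ρ` of `(j, f, d)`,
`ρ ∘ x ∈ Φ₃ ↔ act' j f d (toPt' x) ∈ phi'`. [cite: GaoUllmo2025, Thm 3.1 (3.2)] -/
theorem comp_mem_iff_act'_mem_phi' {ρ : ℂ ≃+* ℂ} {j : ZMod 3} {f d : Bool}
    (hρ : ∀ s : Kf i₁ →+* ℂ, e ((ρ : ℂ →+* ℂ).comp s) =
      ((if f then -(e s).1 else (e s).1) + j, if d then (e s).2 else !(e s).2))
    (x : (j : Fin 3) × (Kf (curveSlots i₀ i₁ j) →+* ℂ)) :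
    (ρ : ℂ →+* ℂ).comp x.2 ∈ (Φ₃ x.1).1 ↔ act' j f d (toPt' e τ x) ∈ phi' := by
  rcases sigma_cases x with ⟨σ, rfl⟩ | ⟨m, s, rfl⟩
  · change (ρ : ℂ →+* ℂ).comp σ ∈ (Φ₃ 0).1 ↔ _
    rw [hΨ, toPt'_zero, act'_inl, mem_phi'_inl, comp_eq_iff_of_realises hττ hk he_sign ρ hρ σ]
  · change (ρ : ℂ →+* ℂ).comp s ∈ (Φ₃ m.succ).1 ↔ _
    rw [hΦ, hρ, toPt'_succ, act'_inr, mem_phi'_inr, act_mk_apply, mem_phi_iff]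

include hττ hk he_sign he_conj he_gal hΨ hΦ in
/-- **FRAME TRANSFER (three slots)**: an `Aut(ℂ)`-balanced weight of `⨁ A₃` maps to a balanced weight of the
14-point model. [cite: GaoUllmo2025, Thm 3.1 (3.2)] -/
theorem balanced'_image_of_isGaloisBalancedAlg {S : Finset ((j : Fin 3) × (Kf (curveSlots i₀ i₁ j) →+* ℂ))}
    (hS : IsGaloisBalancedAlg (K := fun j => Kf (curveSlots i₀ i₁ j)) Φ₃ S) :
    balanced' (S.image (toPt' e τ)) = true := by
  rw [balanced', decide_eq_true_eq]
  intro g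
  obtain ⟨ρ, hρ⟩ := exists_ringEquiv_realises he_conj he_gal g.1 g.2.1 g.2.2
  rw [← ncard_sep_eq_card_filter_image' hττ hk S (fun x => (ρ : ℂ →+* ℂ).comp x.2 ∈ (Φ₃ x.1).1)
      (fun y => act' g.1 g.2.1 g.2.2 y ∈ phi') (comp_mem_iff_act'_mem_phi' hττ hk he_sign hΨ hΦ hρ),
    ← ncard_sep_eq_card_filter_image' hττ hk S (fun x => (ρ : ℂ →+* ℂ).comp x.2 ∉ (Φ₃ x.1).1)
      (fun y => act' g.1 g.2.1 g.2.2 y ∉ phi') (fun x => (comp_mem_iff_act'_mem_phi' hττ hk he_sign hΨ hΦ hρ x).not)]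
  exact hS ρ

omit [∀ i, Field (Kf i)] in
/-- Complex conjugation on the curve slot of the index set. [folklore] -/
theorem conj_smul_zero [∀ i, Field (Kf i)] (σ : Kf i₀ →+* ℂ) :
    (starRingAut : ℂ ≃+* ℂ) • (⟨0, σ⟩ : (j : Fin 3) × (Kf (curveSlots i₀ i₁ j) →+* ℂ)) =
      ⟨0, (ComplexEmbedding.conjugate σ : Kf i₀ →+* ℂ)⟩ :=
  Sigma.ext rfl (heq_of_eq (RingHom.ext fun _ => rfl))

omit [∀ i, Field (Kf i)] in
/-- Complex conjugation on the threefold slots of the index set. [folklore] -/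
theorem conj_smul_succ [∀ i, Field (Kf i)] (m : Fin 2) (s : Kf i₁ →+* ℂ) :
    (starRingAut : ℂ ≃+* ℂ) • (⟨m.succ, s⟩ : (j : Fin 3) × (Kf (curveSlots i₀ i₁ j) →+* ℂ)) =
      ⟨m.succ, (ComplexEmbedding.conjugate s : Kf i₁ →+* ℂ)⟩ :=
  Sigma.ext rfl (heq_of_eq (RingHom.ext fun _ => rfl))

include he_conj hττ hk in
/-- Conjugation is read in the model: `toPt' (x̄) = c · toPt' x`. [folklore] -/
theorem toPt'_conj_smul (x : (j : Fin 3) × (Kf (curveSlots i₀ i₁ j) →+* ℂ)) :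
    toPt' e τ ((starRingAut : ℂ ≃+* ℂ) • x) = act' 0 false false (toPt' e τ x) := by
  rcases sigma_cases x with ⟨σ, rfl⟩ | ⟨m, s, rfl⟩
  · have key : decide (ComplexEmbedding.conjugate σ = τ) = !decide (σ = τ) := by
      rcases hk σ with rfl | rfl
      · rw [decide_eq_false hττ]; simp
      · rw [ComplexEmbedding.involutive_conjugate, decide_eq_false hττ]; simp
    rw [conj_smul_zero]
    show (Sum.inl (decide (ComplexEmbedding.conjugate σ = τ)) : Pt') =
      Sum.inl (if false then decide (σ = τ) else !decide (σ = τ))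
    rw [key]
    simp
  · rw [conj_smul_succ]
    show (Sum.inr (m, e (ComplexEmbedding.conjugate s)) : Pt') = Sum.inr (act 0 false false (m, e s))
    rw [he_conj, act_mk_apply]
    simp

end Transfer

/-! ## §2 Model decompositions yield algebraic weight lines -/

section Decomp

variable {I : Type} {Kf : I → Type} [∀ i, Field (Kf i)] [∀ i, NumberField (Kf i)] [∀ i, IsCMField (Kf i)]
  {i₀ i₁ : I} {e : (Kf i₁ →+* ℂ) ≃ ZMod 3 × Bool} {τ : Kf i₀ →+* ℂ}
  (hττ : ComplexEmbedding.conjugate τ ≠ τ) (hk : ∀ σ : Kf i₀ →+* ℂ, σ = τ ∨ σ = ComplexEmbedding.conjugate τ)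
  (he_conj : ∀ s : Kf i₁ →+* ℂ, e (ComplexEmbedding.conjugate s) = ((e s).1, !(e s).2))
  {A₃ : Fin 3 → AbelianVariety ℂ} {Φ₃ : ∀ j : Fin 3, CMType (Kf (curveSlots i₀ i₁ j))}
  {ι₃ : ∀ j, 𝓞 (Kf (curveSlots i₀ i₁ j)) →+* End (A₃ j)}
  {θ₃ : ∀ j, Kf (curveSlots i₀ i₁ j) →+* Module.End ℂ (complexBetti (A₃ j).X 1)}
  (hA : ∀ j, IsCMTypeRealisation (Φ₃ j) (A₃ j) (ι₃ j) (θ₃ j))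
  (hweil4 : ∀ (m : Fin 2) (b : Bool) (T : Finset ((j : Fin 3) × (Kf (curveSlots i₀ i₁ j) →+* ℂ))),
    T.image (toPt' e τ) = weil4 m b →
      weightClassesAlg A₃ ι₃ (2 * 2) T ≤ algebraicClasses (⨁ A₃).X 2)
  (hpair6 : ∀ (b : Bool) (T : Finset ((j : Fin 3) × (Kf (curveSlots i₀ i₁ j) →+* ℂ))),
    T.image (toPt' e τ) = pair6 b →
      weightClassesAlg A₃ ι₃ (2 * 3) T ≤ algebraicClasses (⨁ A₃).X 3)

include hττ hk he_conj hA in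
/-- A weight whose model image is a conjugate pair is a conjugate pair, so its line is algebraic (a divisor class).
[cite: Gordon1999HodgeAVSurvey, 9.2.2] -/
theorem weightClassesAlg_le_algebraicClasses_of_image_eq_conjPair
    {T : Finset ((j : Fin 3) × (Kf (curveSlots i₀ i₁ j) →+* ℂ))} {y : Pt'} (hT : T.image (toPt' e τ) = conjPair y) :
    T.card = 2 ∧ weightClassesAlg A₃ ι₃ (2 * 1) T ≤ algebraicClasses (⨁ A₃).X 1 := by
  have hinj := toPt'_injective (e := e) hττ hk (i₁ := i₁)
  have hcard : T.card = 2 := by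
    rw [← Finset.card_image_of_injective T hinj, hT, conjPair, Finset.card_pair]
    exact fun h => (Census.DihedralSexticPairCurve.isCMType_phi'.2.2 y) h.symm
  refine ⟨hcard, weightClassesAlg_le_algebraicClasses_of_conj_smul_mem hA (m := 1) hcard fun x hx => ?_⟩
  have hx' : toPt' e τ x ∈ conjPair y := hT ▸ Finset.mem_image_of_mem _ hx
  have hcx : toPt' e τ ((starRingAut : ℂ ≃+* ℂ) • x) ∈ T.image (toPt' e τ) := by
    rw [toPt'_conj_smul hττ hk he_conj x, hT, mem_conjPair_iff] at *
    rcases hx' with h | h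
    · exact Or.inr (by rw [h])
    · exact Or.inl (by rw [h, Census.DihedralSexticPairCurve.isCMType_phi'.2.1])
  exact (hinj.mem_finset_image).1 hcx

include hττ hk he_conj hA hweil4 hpair6 in
/-- **A greedy model decomposition of the image of `S` into generating weights makes the weight line of `S`
algebraic** (induction on the fuel; conjugate pairs, `weil4`, `pair6` pieces, glued by
`PairWeights.weightClassesAlg_union_le_algebraicClasses`). [cite: Milne2020HodgeClassesAV, 1.2 (a)]
[cite: VoisinHodgeII2003, Prop. 9.20] -/
theorem weightClassesAlg_le_algebraicClasses_of_decomp :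
    ∀ (n p : ℕ) (S : Finset ((j : Fin 3) × (Kf (curveSlots i₀ i₁ j) →+* ℂ))), S.card = 2 * p →
      decomp n (S.image (toPt' e τ)) = true → weightClassesAlg A₃ ι₃ (2 * p) S ≤ algebraicClasses (⨁ A₃).X p
  | 0, p, S, hcard, hdec => by
    have hS : S = ∅ := Finset.image_eq_empty.1 ((decomp_zero _).1 hdec)
    subst hS
    obtain rfl : p = 0 := by simpa using hcard.symm
    exact fun c _ => hodgeConjectureFor_codim_zero c
  | n + 1, p, S, hcard, hdec => by
    have hinj := toPt'_injective (e := e) hττ hk (i₁ := i₁)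
    rcases decomp_succ n _ hdec with hS | ⟨g, hg, hgS, hrest⟩
    · have hS' : S = ∅ := Finset.image_eq_empty.1 hS
      subst hS'
      obtain rfl : p = 0 := by simpa using hcard.symm
      exact fun c _ => hodgeConjectureFor_codim_zero c
    · -- split `S = T ⊔ R` along the generator `g`
      set T := S.filter fun x => toPt' e τ x ∈ g with hT_def
      set R := S.filter fun x => toPt' e τ x ∉ g with hR_def
      have hTR : Disjoint T R := Finset.disjoint_filter_filter_not S S _
      have hSTR : S = T.disjUnion R hTR := by
        rw [Finset.disjUnion_eq_union, hT_def, hR_def, Finset.filter_union_filter_not_eq]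
      have hTimg : T.image (toPt' e τ) = g := by
        ext y
        rw [Finset.mem_image]
        constructor
        · rintro ⟨x, hx, rfl⟩
          exact (Finset.mem_filter.1 hx).2
        · intro hy
          obtain ⟨x, hx, rfl⟩ := Finset.mem_image.1 (hgS hy)
          exact ⟨x, Finset.mem_filter.2 ⟨hx, hy⟩, rfl⟩
      have hRimg : R.image (toPt' e τ) = S.image (toPt' e τ) \ g := by
        ext y
        rw [Finset.mem_sdiff, Finset.mem_image, Finset.mem_image]
        constructor
        · rintro ⟨x, hx, rfl⟩
          exact ⟨⟨x, (Finset.mem_filter.1 hx).1, rfl⟩, (Finset.mem_filter.1 hx).2⟩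
        · rintro ⟨⟨x, hx, rfl⟩, hy⟩
          exact ⟨x, Finset.mem_filter.2 ⟨hx, hy⟩, rfl⟩
      rw [← hRimg] at hrest
      have hTcard : T.card = g.card := by rw [← Finset.card_image_of_injective T hinj, hTimg]
      -- the generator piece: size `2q` and algebraic line
      obtain ⟨q, hq, hTalg⟩ : ∃ q, T.card = 2 * q ∧ weightClassesAlg A₃ ι₃ (2 * q) T ≤ algebraicClasses (⨁ A₃).X q := by
        rcases (mem_gens_iff g).1 hg with ⟨y, rfl⟩ | ⟨m, b, rfl⟩ | rfl | rfl
        · exact ⟨1, weightClassesAlg_le_algebraicClasses_of_image_eq_conjPair hττ hk he_conj hA hTimg⟩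
        · refine ⟨2, ?_, hweil4 m b T hTimg⟩
          rw [hTcard]; exact (gens_balanced.2.1 m b).2.1
        · refine ⟨3, ?_, hpair6 true T hTimg⟩
          rw [hTcard]; exact (gens_balanced.2.2 true).2.1
        · refine ⟨3, ?_, hpair6 false T hTimg⟩
          rw [hTcard]; exact (gens_balanced.2.2 false).2.1
      -- the rest: by induction
      have hRcard : R.card = 2 * (p - q) := by
        have h := Finset.card_disjUnion T R hTR
        rw [← hSTR, hcard, hq] at h
        omega
      have hqp : q ≤ p := by
        have h := Finset.card_disjUnion T R hTR
        rw [← hSTR, hcard, hq] at h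
        omega
      have hRalg := weightClassesAlg_le_algebraicClasses_of_decomp n (p - q) R hRcard hrest
      rw [hSTR]
      exact weightClassesAlg_union_le_algebraicClasses hA (by omega) hq hRcard hTR hTalg hRalg

end Decomp

/-! ## §3 The Hodge conjecture for `⨁ A₃` from the two generator hypotheses -/

section Assembly

variable {I : Type} {Kf : I → Type} [∀ i, Field (Kf i)] [∀ i, NumberField (Kf i)] [∀ i, IsCMField (Kf i)]
  {i₀ i₁ : I} {e : (Kf i₁ →+* ℂ) ≃ ZMod 3 × Bool} {τ : Kf i₀ →+* ℂ} {i : Kf i₀ →+* Kf i₁}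
  {A₃ : Fin 3 → AbelianVariety ℂ} {Φ₃ : ∀ j : Fin 3, CMType (Kf (curveSlots i₀ i₁ j))}
  {ι₃ : ∀ j, 𝓞 (Kf (curveSlots i₀ i₁ j)) →+* End (A₃ j)}
  {θ₃ : ∀ j, Kf (curveSlots i₀ i₁ j) →+* Module.End ℂ (complexBetti (A₃ j).X 1)}

/-- **`HodgeConjectureFor (⨁ A₃)` from the census and the generators**: given the frame of `K = Kf i₁` over
`(k, i, τ)`, `Φ₃ 0 = {τ}`, `Φ₃ (m+1)` of sign `true` exactly over the place `m`, and the algebraicity of the weight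
lines over the `weil4` and `pair6` model weights, every rational `(p,p)`-class of `⨁ A₃` is algebraic (Pohlmann's
theorem `Pohlmann1968_thm1_cmAlgebra` for `k × K × K`, frame transfer, census `balanced'_decomp`, §2).
[cite: Pohlmann1968, Thm 1] [cite: GaoUllmo2025, Thm 3.1] [cite: Gordon1999HodgeAVSurvey, 9.2.2] -/
theorem hodgeConjectureFor_biproduct_curveSlots_of_generators
    (hττ : ComplexEmbedding.conjugate τ ≠ τ) (hk : ∀ σ : Kf i₀ →+* ℂ, σ = τ ∨ σ = ComplexEmbedding.conjugate τ)
    (hA : ∀ j, IsCMTypeRealisation (Φ₃ j) (A₃ j) (ι₃ j) (θ₃ j))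
    (he_conj : ∀ s : Kf i₁ →+* ℂ, e (ComplexEmbedding.conjugate s) = ((e s).1, !(e s).2))
    (he_sign : ∀ s : Kf i₁ →+* ℂ, s.comp i = τ ↔ (e s).2 = true)
    (he_gal : ∀ (j : ZMod 3) (f : Bool), ∃ σ : ℂ ≃+* ℂ, ∀ s : Kf i₁ →+* ℂ,
      e ((σ : ℂ →+* ℂ).comp s) = ((if f then -(e s).1 else (e s).1) + j, (e s).2))
    (hΨ : ∀ σ : Kf i₀ →+* ℂ, σ ∈ (Φ₃ 0).1 ↔ σ = τ)
    (hΦ : ∀ (m : Fin 2) (s : Kf i₁ →+* ℂ), s ∈ (Φ₃ m.succ).1 ↔ (e s).2 = decide ((e s).1.val = m.val))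
    (hweil4 : ∀ (m : Fin 2) (b : Bool) (T : Finset ((j : Fin 3) × (Kf (curveSlots i₀ i₁ j) →+* ℂ))),
      T.image (toPt' e τ) = weil4 m b → weightClassesAlg A₃ ι₃ (2 * 2) T ≤ algebraicClasses (⨁ A₃).X 2)
    (hpair6 : ∀ (b : Bool) (T : Finset ((j : Fin 3) × (Kf (curveSlots i₀ i₁ j) →+* ℂ))),
      T.image (toPt' e τ) = pair6 b → weightClassesAlg A₃ ι₃ (2 * 3) T ≤ algebraicClasses (⨁ A₃).X 3) :
    HodgeConjectureFor (⨁ A₃).dim (⨁ A₃).X := by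
  refine ⟨nonempty_hodgeModel_holds (Motives.AbelianVariety.isSmoothProjective_holds (A := ⨁ A₃)),
    fun p c hc hH => ?_⟩
  have hmem : c ∈ ⨆ S ∈ pohlmannSetsAlg Φ₃ p, weightClassesAlg A₃ ι₃ (2 * p) S := by
    rw [← (Pohlmann1968_thm1_cmAlgebra (fun j => Kf (curveSlots i₀ i₁ j)) A₃ Φ₃ ι₃ θ₃ hA p).1]
    exact Submodule.subset_span ⟨hc, hH⟩
  have hle : (⨆ S ∈ pohlmannSetsAlg Φ₃ p, weightClassesAlg A₃ ι₃ (2 * p) S) ≤ algebraicClasses (⨁ A₃).X p := by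
    refine iSup₂_le fun S hS => ?_
    exact weightClassesAlg_le_algebraicClasses_of_decomp hττ hk he_conj hA hweil4 hpair6 7 p S hS.1
      (balanced'_decomp _ (balanced'_image_of_isGaloisBalancedAlg hττ hk he_sign he_conj he_gal hΨ hΦ hS.2))
  exact hle hmem

end Assembly

end Summit.HodgeConjecture.CorCM.DihedralSexticPairCurve

end
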